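import Literature.Analysis.Distribution.SchwartzBoundaryFlatness
import Mathlib.Analysis.LocallyConvex.HahnBanach
import Mathlib.MeasureTheory.Integral.Bochner.Basic
import HarnessLib

/-!
# Kernels blowing up polynomially at the boundary of an open set pair continuously with the
Schwartz functions supported in the set; Hahn–Banach extension to a tempered distribution

Topic `Literature/Analysis/Distribution`, sequel of `SchwartzBoundaryFlatness`. Let `V` be a
finite-dimensional real normed space, `U ⊆ V` open, and `g` continuous on `U` with

  `‖g x‖ ≤ C (1 + ‖x‖)ᴺ (1 + (infDist x Uᶜ)⁻¹)ᴹ`,  `x ∈ U`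

(polynomial growth at infinity, polynomial blow-up at `∂U` — the shape of the Osterwalder–Schrader
bounds on continued Wightman functions at Euclidean points, OS I (1973), §4). Then:

* `SchwartzMap.one_add_pow_mul_norm_le_seminorm_mul_infDist_pow` — the flatness lemma
  `SchwartzMap.exists_one_add_pow_mul_norm_le_infDist_pow` of `SchwartzBoundaryFlatness` with its
  constant made an explicit Schwartz seminorm:
  `(1 + ‖x‖)ᵏ ‖F x‖ ≤ 4ᵏ ‖F‖_{≤(k,M)} (infDist x Uᶜ)ᴹ` for `tsupport F ⊆ U`, `Uᶜ ≠ ∅`;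
* `exists_bound_integral_mul_of_tsupport_subset` — for every Schwartz `F` with `tsupport F ⊆ U`
  the product `g F` is integrable (any additive Haar measure) and `‖∫ g F‖ ≤ A ‖F‖ₛ` for one
  finite sup `‖·‖ₛ` of Schwartz seminorms and one constant `A`, both independent of `F`
  (the case `U = V` by plain Schwartz decay);
* `supportedIn U` — the submodule `{F ∈ 𝓢(V, ℂ) | tsupport F ⊆ U}` (Osterwalder–Schrader's `𝒮_<`
  when `U` is the time-ordered region);
* `exists_clm_eq_integral_mul_of_tsupport_subset` — **there is `Λ ∈ 𝒮'(V)` with `Λ F = ∫ g F`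
  for all `F` with `tsupport F ⊆ U`**: the pairing is a linear functional on `supportedIn U`
  dominated by a continuous seminorm of the polynormable space `𝓢(V, ℂ)`, and Mathlib's
  Hahn–Banach theorem `Module.Dual.exists_continuous_extension_of_le_seminorm` extends it. This is
  the step "(4.12) defines continuous linear functionals on `𝒮_<` (4.13), which extend to `𝒮`
  (4.14)" of Osterwalder–Schrader I, §4, used by
  `Literature/MathematicalPhysics/QuantumFieldTheory/WightmanToSchwingerProofs`.

## References

* K. Osterwalder, R. Schrader, *Axioms for Euclidean Green's functions*, Comm. Math. Phys. 31
  (1973) 83–112, §4, eqs. (4.12)–(4.14). [OsterwalderSchraderCMP1973]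

## Mathlib

Used: `Module.Dual.exists_continuous_extension_of_le_seminorm`,
`WithSeminorms.toPolynormableSpace`, `schwartz_withSeminorms`, `Seminorm.continuous_finsetSup`,
`SchwartzMap.one_add_le_sup_seminorm_apply`, `integrable_one_add_norm`,
`IsClosed.exists_infDist_eq_dist`, `norm_apply_add_le_of_iteratedFDeriv_eq_zero`
(`SchwartzBoundaryFlatness`). Everything here is elementary analysis; no field theory is imported.
-/

noncomputable section

open Set Filter Metric MeasureTheory SchwartzMap
open scoped ContDiff Topology SchwartzMap

namespace Literature.Analysis.Distribution

section Extension

variable {V : Type*} [NormedAddCommGroup V] [NormedSpace ℝ V]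

/-- The submodule of Schwartz functions whose topological support lies in `U` (for
`U = {0 < x₀⁰ < ⋯ < x_{n-1}⁰}` this is Osterwalder–Schrader's space `𝒮_<`, OS I (1973), §4).
[cite: OsterwalderSchraderCMP1973, §4] -/
def supportedIn (U : Set V) : Submodule ℂ 𝓢(V, ℂ) where
  carrier := {F | tsupport (F : V → ℂ) ⊆ U}
  zero_mem' := by
    show tsupport ((0 : 𝓢(V, ℂ)) : V → ℂ) ⊆ U
    rw [FunLike.coe_zero, tsupport_zero]
    exact empty_subset _
  add_mem' {F G} hF hG := by
    refine Set.Subset.trans ?_ (union_subset hF hG)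
    exact tsupport_add (F : V → ℂ) (G : V → ℂ)
  smul_mem' c F hF := by
    refine Set.Subset.trans ?_ hF
    exact tsupport_smul_subset_right (fun _ : V => c) (F : V → ℂ)

/-- Membership in `supportedIn U`. [folklore] -/
@[simp]
theorem mem_supportedIn {U : Set V} {F : 𝓢(V, ℂ)} :
    F ∈ supportedIn U ↔ tsupport (F : V → ℂ) ⊆ U := Iff.rfl

variable [FiniteDimensional ℝ V]

/-- **Quantitative flatness with an explicit seminorm** (the constant of
`SchwartzMap.exists_one_add_pow_mul_norm_le_infDist_pow` made explicit): for `U` open with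
`Uᶜ ≠ ∅`, `F ∈ 𝓢(V, ℂ)` with `tsupport F ⊆ U`, and all `k, M`,
`(1 + ‖x‖)ᵏ ‖F x‖ ≤ 4ᵏ · sup_{(k',M') ≤ (k,M)} ‖F‖_{k',M'} · (infDist x Uᶜ)ᴹ`. Same proof (Taylor
along the segment from a nearest boundary point, where `F` is flat). A deliberate dot-notation
extension of Mathlib's `SchwartzMap` namespace, like the tree's lemma it quantifies. [folklore] -/
theorem _root_.SchwartzMap.one_add_pow_mul_norm_le_seminorm_mul_infDist_pow {U : Set V}
    (hU : IsOpen U) (hUc : Uᶜ.Nonempty) (k M : ℕ) (F : 𝓢(V, ℂ))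
    (hsupp : tsupport (F : V → ℂ) ⊆ U) (x : V) :
    (1 + ‖x‖) ^ k * ‖F x‖ ≤
      4 ^ k * (Finset.Iic (k, M)).sup (schwartzSeminormFamily ℂ V ℂ) F * infDist x Uᶜ ^ M := by
  set P : ℝ := (Finset.Iic (k, M)).sup (schwartzSeminormFamily ℂ V ℂ) F with hP
  have hP0 : 0 ≤ P := apply_nonneg _ _
  set S : ℝ := 2 ^ k * P with hS
  have h4 : (4 : ℝ) ^ k * P = 2 ^ k * S := by
    rw [hS, ← mul_assoc, ← mul_pow]; norm_num
  rw [h4]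
  have hS0 : 0 ≤ S := by positivity
  have hSF : ∀ y : V, (1 + ‖y‖) ^ k * ‖F y‖ ≤ S := fun y => by
    have h := SchwartzMap.one_add_le_sup_seminorm_apply (𝕜 := ℂ) (m := (k, M)) (k := k) (n := 0)
      le_rfl (Nat.zero_le M) F y
    rw [norm_iteratedFDeriv_zero] at h
    exact h
  have hSD : ∀ y : V, (1 + ‖y‖) ^ k * ‖iteratedFDeriv ℝ M F y‖ ≤ S := fun y =>
    SchwartzMap.one_add_le_sup_seminorm_apply (𝕜 := ℂ) (m := (k, M)) (k := k) (n := M)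
      le_rfl le_rfl F y
  have hx0 : 0 < 1 + ‖x‖ := by positivity
  by_cases hxU : x ∈ U
  swap
  · have hFx : F x = 0 := image_eq_zero_of_notMem_tsupport fun h => hxU (hsupp h)
    rw [hFx, norm_zero, mul_zero]
    exact mul_nonneg (by positivity) (pow_nonneg infDist_nonneg _)
  set r : ℝ := infDist x Uᶜ with hr
  have hr0 : 0 ≤ r := infDist_nonneg
  by_cases hr1 : 1 ≤ r
  · calc (1 + ‖x‖) ^ k * ‖F x‖ ≤ S := hSF x
      _ ≤ 2 ^ k * S * r ^ M := by
        have h1 : S ≤ 2 ^ k * S := le_mul_of_one_le_left hS0 (one_le_pow₀ (by norm_num))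
        have h2 : (1 : ℝ) ≤ r ^ M := one_le_pow₀ hr1
        nlinarith [mul_nonneg (by positivity : (0 : ℝ) ≤ 2 ^ k) hS0]
  · push Not at hr1
    obtain ⟨b, hbU, hbd⟩ := hU.isClosed_compl.exists_infDist_eq_dist hUc x
    have hb : b ∉ tsupport (F : V → ℂ) := fun h => hbU (hsupp h)
    set v : V := x - b with hv
    have hxv : b + v = x := by rw [hv, add_sub_cancel]
    have hvr : ‖v‖ = r := by rw [hr, hbd, dist_eq_norm]
    have h0 : ∀ j < M, iteratedFDeriv ℝ j F b = 0 := fun j _ =>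
      image_eq_zero_of_notMem_tsupport fun h => hb (tsupport_iteratedFDeriv_subset j h)
    set B : ℝ := 2 ^ k * S / (1 + ‖x‖) ^ k with hBdef
    have hB : ∀ t ∈ Icc (0 : ℝ) 1, ‖iteratedFDeriv ℝ M F (b + t • v)‖ ≤ B := by
      intro t ht
      set y := b + t • v with hy
      have hyx : ‖y - x‖ ≤ 1 := by
        have : y - x = (t - 1) • v := by
          rw [hy, ← hxv, sub_smul, one_smul]; abel
        rw [this, norm_smul, Real.norm_eq_abs, abs_of_nonpos (by linarith [ht.2]), hvr]
        nlinarith [ht.1, ht.2]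
      have hw : (1 + ‖x‖) ^ k ≤ 2 ^ k * (1 + ‖y‖) ^ k := by
        rw [← mul_pow]
        exact pow_le_pow_left₀ hx0.le (one_add_norm_le_two_mul hyx) k
      rw [hBdef, le_div_iff₀ (pow_pos hx0 k)]
      calc ‖iteratedFDeriv ℝ M F y‖ * (1 + ‖x‖) ^ k
          ≤ ‖iteratedFDeriv ℝ M F y‖ * (2 ^ k * (1 + ‖y‖) ^ k) := by gcongr
        _ = 2 ^ k * ((1 + ‖y‖) ^ k * ‖iteratedFDeriv ℝ M F y‖) := by ring
        _ ≤ 2 ^ k * S := by gcongr; exact hSD y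
    have hmain := norm_apply_add_le_of_iteratedFDeriv_eq_zero (F.smooth ⊤) M b v h0 hB
    rw [hxv, hvr] at hmain
    calc (1 + ‖x‖) ^ k * ‖F x‖ ≤ (1 + ‖x‖) ^ k * (B * r ^ M) := by gcongr
      _ = 2 ^ k * S * r ^ M := by
        rw [hBdef]
        field_simp

/-- A function continuous on an open set `U`, multiplied by a continuous function whose
topological support lies in `U`, is continuous everywhere (private copy of the elementary lemma
`Literature.MathematicalPhysics.QuantumFieldTheory.continuous_mul_of_tsupport_subset` of `Wightman`,
which a generic analysis file must not import; cf. the private copy in `SchwartzBoundaryFlatness`).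
[folklore] -/
private theorem continuous_mul_of_continuousOn_of_tsupport_subset' {X : Type*}
    [TopologicalSpace X] {U : Set X} (hU : IsOpen U) {g φ : X → ℂ} (hg : ContinuousOn g U)
    (hφ : Continuous φ) (hsupp : tsupport φ ⊆ U) : Continuous fun x => g x * φ x := by
  refine continuous_iff_continuousAt.2 fun x => ?_
  by_cases hx : x ∈ tsupport φ
  · exact (hg.continuousAt (hU.mem_nhds (hsupp hx))).mul hφ.continuousAt
  · have hφ0 : φ =ᶠ[𝓝 x] 0 := notMem_tsupport_iff_eventuallyEq.1 hx
    refine Filter.EventuallyEq.continuousAt (y := 0) ?_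
    filter_upwards [hφ0] with y hy
    simp [hy]

variable [MeasurableSpace V] [BorelSpace V]

/-- Integrability and the bound of the integral from a pointwise domination by
`K (1 + ‖x‖)^{−(dim V + 1)}`. [folklore] -/
theorem integrable_and_norm_integral_le_of_norm_le (μ : Measure V) [μ.IsAddHaarMeasure]
    {h : V → ℂ} (hh : AEStronglyMeasurable h μ) {K : ℝ}
    (hK : ∀ x, ‖h x‖ ≤ K * (1 + ‖x‖) ^ (-((Module.finrank ℝ V : ℝ) + 1))) :
    Integrable h μ ∧
      ‖∫ x, h x ∂μ‖ ≤ K * ∫ x : V, (1 + ‖x‖) ^ (-((Module.finrank ℝ V : ℝ) + 1)) ∂μ := by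
  have hdom : Integrable (fun x : V => K * (1 + ‖x‖) ^ (-((Module.finrank ℝ V : ℝ) + 1))) μ :=
    (integrable_one_add_norm (by linarith)).const_mul K
  have hint : Integrable h μ := hdom.mono' hh (Eventually.of_forall hK)
  refine ⟨hint, ?_⟩
  calc ‖∫ x, h x ∂μ‖ ≤ ∫ x, ‖h x‖ ∂μ := norm_integral_le_integral_norm _
    _ ≤ ∫ x, K * (1 + ‖x‖) ^ (-((Module.finrank ℝ V : ℝ) + 1)) ∂μ :=
        integral_mono hint.norm hdom hK
    _ = K * ∫ x : V, (1 + ‖x‖) ^ (-((Module.finrank ℝ V : ℝ) + 1)) ∂μ := integral_const_mul _ _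

/-- **The Euclidean pairing is bounded by a Schwartz seminorm.** Let `U` be open, `g` continuous
on `U` with `‖g x‖ ≤ C (1 + ‖x‖)ᴺ (1 + (infDist x Uᶜ)⁻¹)ᴹ` there (polynomial growth at infinity
and polynomial blow-up at the boundary — the shape of the Osterwalder–Schrader bound on the
continued Wightman functions at Euclidean points, OS I (1973), §4, and OS II (1975), (4.6)). Then
for every Schwartz `F` with `tsupport F ⊆ U` the product `g F` is integrable and
`‖∫ g F‖ ≤ A · sup_{m ∈ s} ‖F‖ₘ` for a finite set `s` of Schwartz seminorms and a constant `A`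
independent of `F`: by flatness of `F` at `∂U` (previous lemma) when `Uᶜ ≠ ∅`, and by plain
Schwartz decay when `U = V`. [cite: OsterwalderSchraderCMP1973, §4 eqs. (4.12)–(4.14)] -/
theorem exists_bound_integral_mul_of_tsupport_subset (μ : Measure V) [μ.IsAddHaarMeasure]
    {U : Set V} (hU : IsOpen U) {g : V → ℂ} (hg : ContinuousOn g U) {C : ℝ} {N M : ℕ}
    (hbound : ∀ x ∈ U, ‖g x‖ ≤ C * (1 + ‖x‖) ^ N * (1 + (infDist x Uᶜ)⁻¹) ^ M) :
    ∃ (s : Finset (ℕ × ℕ)) (A : ℝ), 0 ≤ A ∧ ∀ F : 𝓢(V, ℂ), tsupport (F : V → ℂ) ⊆ U →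
      Integrable (fun x => g x * F x) μ ∧
        ‖∫ x, g x * F x ∂μ‖ ≤ A * (s.sup (schwartzSeminormFamily ℂ V ℂ)) F := by
  set D : ℕ := Module.finrank ℝ V with hD
  set I₀ : ℝ := ∫ x : V, (1 + ‖x‖) ^ (-((D : ℝ) + 1)) ∂μ with hI₀
  have hI₀0 : 0 ≤ I₀ := integral_nonneg fun x => by positivity
  set Cp : ℝ := max C 0 with hCp
  have hCp0 : 0 ≤ Cp := le_max_right _ _
  have hrpow : ∀ x : V, (1 + ‖x‖) ^ (-((D : ℝ) + 1)) = ((1 + ‖x‖) ^ (D + 1))⁻¹ := fun x => by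
    have hx0 : 0 < 1 + ‖x‖ := by positivity
    rw [Real.rpow_neg hx0.le, ← Real.rpow_natCast]
    push_cast
    ring_nf
  -- measurability of the integrand for `tsupport F ⊆ U`
  have hmeas : ∀ F : 𝓢(V, ℂ), tsupport (F : V → ℂ) ⊆ U →
      AEStronglyMeasurable (fun x => g x * F x) μ := fun F hF =>
    (continuous_mul_of_continuousOn_of_tsupport_subset' hU hg F.continuous hF).aestronglyMeasurable
  by_cases hUc : Uᶜ.Nonempty
  · -- flat case
    obtain ⟨b₀, hb₀⟩ := hUc
    set k : ℕ := N + M + (D + 1) with hk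
    set K₀ : ℝ := Cp * (1 + ‖b₀‖) ^ M * 4 ^ k with hK₀
    refine ⟨Finset.Iic (k, M), K₀ * I₀, by positivity, fun F hF => ?_⟩
    set P : ℝ := (Finset.Iic (k, M)).sup (schwartzSeminormFamily ℂ V ℂ) F with hP
    have hP0 : 0 ≤ P := apply_nonneg _ _
    have hpt : ∀ x, ‖g x * F x‖ ≤ K₀ * P * (1 + ‖x‖) ^ (-((D : ℝ) + 1)) := by
      intro x
      have hx0 : 0 < 1 + ‖x‖ := by positivity
      rw [hrpow]
      by_cases hxU : x ∈ U
      swap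
      · have hFx : F x = 0 := image_eq_zero_of_notMem_tsupport fun h => hxU (hF h)
        rw [hFx, mul_zero, norm_zero]
        positivity
      set r : ℝ := infDist x Uᶜ with hr
      have hrpos : 0 < r :=
        (hU.isClosed_compl.notMem_iff_infDist_pos ⟨b₀, hb₀⟩).1 (fun h => h hxU)
      have hg1 : ‖g x‖ ≤ Cp * (1 + ‖x‖) ^ N * (1 + r⁻¹) ^ M :=
        (hbound x hxU).trans (by gcongr; exact le_max_left _ _)
      have hF1 : ‖F x‖ ≤ 4 ^ k * P * r ^ M / (1 + ‖x‖) ^ k := by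
        rw [le_div_iff₀ (pow_pos hx0 _), mul_comm]
        exact F.one_add_pow_mul_norm_le_seminorm_mul_infDist_pow hU ⟨b₀, hb₀⟩ k M hF x
      -- `1 + r ≤ (1 + ‖b₀‖)(1 + ‖x‖)` and `(1 + r⁻¹) r = 1 + r`
      have hr1 : 1 + r ≤ (1 + ‖b₀‖) * (1 + ‖x‖) := by
        have h1 : r ≤ ‖x‖ + ‖b₀‖ := by
          calc r ≤ dist x b₀ := infDist_le_dist_of_mem hb₀
            _ = ‖x - b₀‖ := dist_eq_norm _ _
            _ ≤ ‖x‖ + ‖b₀‖ := norm_sub_le _ _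
        nlinarith [norm_nonneg x, norm_nonneg b₀]
      have hinv : (1 + r⁻¹) * r = 1 + r := by
        rw [add_mul, inv_mul_cancel₀ hrpos.ne', one_mul, add_comm]
      have hpow : ((1 + r⁻¹) * r) ^ M ≤ ((1 + ‖b₀‖) * (1 + ‖x‖)) ^ M := by
        rw [hinv]; exact pow_le_pow_left₀ (by positivity) hr1 M
      rw [norm_mul]
      calc ‖g x‖ * ‖F x‖
          ≤ (Cp * (1 + ‖x‖) ^ N * (1 + r⁻¹) ^ M) * (4 ^ k * P * r ^ M / (1 + ‖x‖) ^ k) := by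
            gcongr
        _ = Cp * 4 ^ k * P * ((1 + r⁻¹) * r) ^ M * (1 + ‖x‖) ^ N / (1 + ‖x‖) ^ k := by
            rw [mul_pow]; ring
        _ ≤ Cp * 4 ^ k * P * ((1 + ‖b₀‖) * (1 + ‖x‖)) ^ M * (1 + ‖x‖) ^ N / (1 + ‖x‖) ^ k := by
            gcongr
        _ = K₀ * P * ((1 + ‖x‖) ^ (D + 1))⁻¹ := by
            rw [hK₀, hk, mul_pow]
            field_simp
            ring
    obtain ⟨hint, hle⟩ := integrable_and_norm_integral_le_of_norm_le μ (hmeas F hF) hpt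
    refine ⟨hint, hle.trans (le_of_eq ?_)⟩
    rw [hI₀]; ring
  · -- `U = V`: plain Schwartz decay
    have hUuniv : Uᶜ = ∅ := not_nonempty_iff_eq_empty.1 hUc
    set k : ℕ := N + (D + 1) with hk
    set K₀ : ℝ := Cp * 2 ^ k with hK₀
    refine ⟨Finset.Iic (k, 0), K₀ * I₀, by positivity, fun F hF => ?_⟩
    set P : ℝ := (Finset.Iic (k, 0)).sup (schwartzSeminormFamily ℂ V ℂ) F with hP
    have hP0 : 0 ≤ P := apply_nonneg _ _
    have hpt : ∀ x, ‖g x * F x‖ ≤ K₀ * P * (1 + ‖x‖) ^ (-((D : ℝ) + 1)) := by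
      intro x
      have hx0 : 0 < 1 + ‖x‖ := by positivity
      have hxU : x ∈ U := by
        by_contra h
        have : x ∈ Uᶜ := h
        rw [hUuniv] at this
        exact this
      rw [hrpow]
      have hg1 : ‖g x‖ ≤ Cp * (1 + ‖x‖) ^ N := by
        have h := hbound x hxU
        rw [hUuniv, infDist_empty, inv_zero, add_zero, one_pow, mul_one] at h
        exact h.trans (by gcongr; exact le_max_left _ _)
      have hF1 : (1 + ‖x‖) ^ k * ‖F x‖ ≤ 2 ^ k * P := by
        have h := SchwartzMap.one_add_le_sup_seminorm_apply (𝕜 := ℂ) (m := (k, 0)) (k := k)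
          (n := 0) le_rfl le_rfl F x
        rw [norm_iteratedFDeriv_zero] at h
        exact h
      have hF2 : ‖F x‖ ≤ 2 ^ k * P / (1 + ‖x‖) ^ k := by
        rw [le_div_iff₀ (pow_pos hx0 _), mul_comm]; exact hF1
      rw [norm_mul]
      calc ‖g x‖ * ‖F x‖ ≤ (Cp * (1 + ‖x‖) ^ N) * (2 ^ k * P / (1 + ‖x‖) ^ k) := by gcongr
        _ = K₀ * P * ((1 + ‖x‖) ^ (D + 1))⁻¹ := by
            rw [hK₀, hk]
            field_simp
            ring
    obtain ⟨hint, hle⟩ := integrable_and_norm_integral_le_of_norm_le μ (hmeas F hF) hpt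
    refine ⟨hint, hle.trans (le_of_eq ?_)⟩
    rw [hI₀]; ring

/-- **A kernel blowing up polynomially at the boundary of an open set defines a tempered
distribution on test functions supported in the set, and it extends to all of `𝒮`.** With `U`,
`g` as in `exists_bound_integral_mul_of_tsupport_subset` there is `Λ ∈ 𝒮'(V)` with
`Λ(F) = ∫ g F` for every `F ∈ 𝓢` with `tsupport F ⊆ U`: the pairing is a linear functional on
the subspace `supportedIn U` dominated by a continuous seminorm of `𝓢`, and the
Hahn–Banach theorem on the locally convex (polynormable) space `𝓢` extends it (this is how
Osterwalder–Schrader I (1973), §4, after (4.12), pass from the Schwinger functions on `𝒮_<` to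
distributions: "they define … continuous linear functionals on `𝒮_<` … which can be extended").
[cite: OsterwalderSchraderCMP1973, §4 eqs. (4.12)–(4.14)] -/
theorem exists_clm_eq_integral_mul_of_tsupport_subset (μ : Measure V) [μ.IsAddHaarMeasure]
    {U : Set V} (hU : IsOpen U) {g : V → ℂ} (hg : ContinuousOn g U) {C : ℝ} {N M : ℕ}
    (hbound : ∀ x ∈ U, ‖g x‖ ≤ C * (1 + ‖x‖) ^ N * (1 + (infDist x Uᶜ)⁻¹) ^ M) :
    ∃ Λ : 𝓢(V, ℂ) →L[ℂ] ℂ, ∀ F : 𝓢(V, ℂ), tsupport (F : V → ℂ) ⊆ U →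
      Λ F = ∫ x, g x * F x ∂μ := by
  obtain ⟨s, A, hA, hF⟩ := exists_bound_integral_mul_of_tsupport_subset μ hU hg hbound
  set E : Submodule ℂ 𝓢(V, ℂ) := supportedIn U with hE
  -- the pairing as a linear functional on `E`
  set f : Module.Dual ℂ E :=
    { toFun := fun F => ∫ x, g x * (F : 𝓢(V, ℂ)) x ∂μ
      map_add' := fun F G => by
        have hFi := (hF F F.2).1
        have hGi := (hF G G.2).1
        simp only [Submodule.coe_add, add_apply, mul_add]
        exact integral_add hFi hGi
      map_smul' := fun c F => by
        simp only [Submodule.coe_smul, smul_apply, smul_eq_mul, RingHom.id_apply]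
        rw [← integral_const_mul]
        congr 1
        funext x
        ring } with hf
  -- the dominating continuous seminorm
  set A' : NNReal := ⟨A, hA⟩ with hA'
  set p : Seminorm ℂ 𝓢(V, ℂ) := A' • s.sup (schwartzSeminormFamily ℂ V ℂ) with hp
  have hp_cont : Continuous p := by
    have h1 := Seminorm.continuous_finsetSup (s := s) (p := schwartzSeminormFamily ℂ V ℂ)
      fun m _ => (schwartz_withSeminorms ℂ V ℂ).continuous_seminorm m
    rw [hp]
    exact h1.const_smul A'
  have hfp : ∀ F : E, ‖f F‖ ≤ p F := fun F => by
    have h := (hF F F.2).2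
    rw [hp, smul_apply, NNReal.smul_def, smul_eq_mul]
    exact h
  haveI : PolynormableSpace ℂ 𝓢(V, ℂ) := (schwartz_withSeminorms ℂ V ℂ).toPolynormableSpace
  obtain ⟨Λ, hΛ, -⟩ := Module.Dual.exists_continuous_extension_of_le_seminorm E f hp_cont hfp
  exact ⟨Λ, fun F hFU => hΛ ⟨F, hFU⟩⟩

end Extension

end Literature.Analysis.Distribution
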